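import Literature.NumberTheory.Sieve.SmoothZetaComplex
import Literature.NumberTheory.Sieve.SmoothSaddlePointApprox
import Mathlib.Analysis.Real.Pi.Bounds
import HarnessLib

/-!
# Decay of `ζ(s, y)` for `π/log y ≤ |t| ≤ 3`: Chebyshev's bounds on a good multiplicative interval

(Module docstring completed once the file is stable.)
-/

noncomputable section

open Real Finset Chebyshev

namespace Literature.NumberTheory.Sieve

/-! ### A good sub-interval avoiding a periodic family of neighbourhoods -/

/-- **Good sub-interval lemma.** Let the "bad" set be the union of the open `r`-neighbourhoods of the
lattice `Pℤ` (`P > 0`, `r ≥ 0`). If the gaps have length `P - 2r ≥ m > 0` and `W ≥ 2m + 2r`, then any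
window `[A, A + W]` contains an interval `[ℓ₀, ℓ₀ + m]` all of whose points are at distance `≥ r` from
`Pℤ`. [folklore] -/
theorem exists_good_subinterval {P r m A W : ℝ} (hP : 0 < P) (hr : 0 ≤ r) (hm : 0 < m)
    (hgap : m ≤ P - 2 * r) (hW : 2 * m + 2 * r ≤ W) :
    ∃ ℓ₀ : ℝ, A ≤ ℓ₀ ∧ ℓ₀ + m ≤ A + W ∧
      ∀ L ∈ Set.Icc ℓ₀ (ℓ₀ + m), ∀ k : ℤ, r ≤ |L - k * P| := by
  by_cases h : ∃ k : ℤ, (k : ℝ) * P - r < A + m ∧ A < k * P + r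
  · -- a bad neighbourhood meets `[A, A + m]`: start right after it
    obtain ⟨k, hk1, hk2⟩ := h
    refine ⟨k * P + r, by linarith, by linarith, fun L hL k' => ?_⟩
    obtain ⟨hL1, hL2⟩ := hL
    rcases le_or_gt k' k with hk' | hk'
    · -- `k' ≤ k`: `L - k'P ≥ L - kP ≥ r`
      have : (k' : ℝ) * P ≤ k * P := mul_le_mul_of_nonneg_right (by exact_mod_cast hk') hP.le
      rw [abs_of_nonneg (by linarith)]
      linarith
    · -- `k' ≥ k + 1`: `k'P - L ≥ (k+1)P - L ≥ r`
      have hk'1 : (k : ℝ) + 1 ≤ k' := by exact_mod_cast hk'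
      have : ((k : ℝ) + 1) * P ≤ k' * P := mul_le_mul_of_nonneg_right hk'1 hP.le
      rw [abs_of_nonpos (by nlinarith)]
      nlinarith
  · -- `[A, A + m]` is entirely good
    push Not at h
    refine ⟨A, le_rfl, by linarith, fun L hL k => ?_⟩
    obtain ⟨hL1, hL2⟩ := hL
    by_cases hk : (k : ℝ) * P + r ≤ A
    · rw [abs_of_nonneg (by linarith)]
      linarith
    · push Not at hk
      have := h k
      have hk2 : A + m ≤ k * P - r := by
        by_contra hlt
        push Not at hlt
        exact absurd hk (not_lt.2 (this hlt))
      rw [abs_of_nonpos (by linarith)]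
      linarith

/-- If `w` keeps distance `≥ ε ≥ 0` from `2πℤ` then `cos w ≤ cos ε`. [folklore] -/
theorem cos_le_cos_of_forall_dist {w ε : ℝ} (hε0 : 0 ≤ ε)
    (h : ∀ k : ℤ, ε ≤ |w - k * (2 * Real.pi)|) : Real.cos w ≤ Real.cos ε := by
  set n : ℤ := ⌊w / (2 * Real.pi)⌋ with hn
  set w₁ : ℝ := w - n * (2 * Real.pi) with hw₁
  have hπ : 0 < Real.pi := Real.pi_pos
  have h2π : 0 < 2 * Real.pi := by positivity
  have hw₁0 : 0 ≤ w₁ := by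
    have := Int.floor_le (w / (2 * Real.pi))
    rw [hw₁, hn]
    have h1 : (⌊w / (2 * Real.pi)⌋ : ℝ) * (2 * Real.pi) ≤ w / (2 * Real.pi) * (2 * Real.pi) :=
      mul_le_mul_of_nonneg_right this h2π.le
    rw [div_mul_cancel₀ _ h2π.ne'] at h1
    linarith
  have hw₁lt : w₁ < 2 * Real.pi := by
    have := Int.lt_floor_add_one (w / (2 * Real.pi))
    rw [hw₁, hn]
    have h1 : w / (2 * Real.pi) * (2 * Real.pi) < ((⌊w / (2 * Real.pi)⌋ : ℝ) + 1) * (2 * Real.pi) :=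
      mul_lt_mul_of_pos_right this h2π
    rw [div_mul_cancel₀ _ h2π.ne'] at h1
    linarith
  have hcos : Real.cos w = Real.cos w₁ := by rw [hw₁, Real.cos_sub_int_mul_two_pi]
  rw [hcos]
  rcases le_or_gt w₁ Real.pi with hle | hgt
  · -- `ε ≤ w₁ ≤ π`
    have hε : ε ≤ w₁ := by
      have := h n
      rwa [← hw₁, abs_of_nonneg hw₁0] at this
    exact Real.cos_le_cos_of_nonneg_of_le_pi hε0 hle hε
  · -- `π < w₁ < 2π`: use `2π - w₁ ∈ [ε, π)`
    have hε : ε ≤ 2 * Real.pi - w₁ := by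
      have := h (n + 1)
      rw [show w - ((n + 1 : ℤ) : ℝ) * (2 * Real.pi) = w₁ - 2 * Real.pi by
        rw [hw₁]; push_cast; ring, abs_of_nonpos (by linarith)] at this
      linarith
    have hcos2 : Real.cos w₁ = Real.cos (2 * Real.pi - w₁) := by
      rw [show 2 * Real.pi - w₁ = ((1 : ℤ) : ℝ) * (2 * Real.pi) - w₁ by push_cast; ring,
        Real.cos_int_mul_two_pi_sub]
    rw [hcos2]
    exact Real.cos_le_cos_of_nonneg_of_le_pi hε0 (by linarith) hε

/-! ### The decay sum `Σ_{p ≤ y} p^{-σ}(1 - cos(t log p))` for `π/log y ≤ |t| ≤ 3` -/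

/-- `e² > 7.38`. [folklore] -/
theorem exp_two_gt : (7.38 : ℝ) < Real.exp 2 := by
  have h := Real.exp_one_gt_d9
  have h0 : (0 : ℝ) ≤ 2.7182818283 := by norm_num
  have h1 : (2.7182818283 : ℝ) ^ 2 < Real.exp 1 ^ 2 := pow_lt_pow_left₀ h h0 (by norm_num)
  have h2 : Real.exp 1 ^ 2 = Real.exp 2 := by rw [Real.exp_one_pow]; norm_num
  rw [h2] at h1
  have h3 : (7.38 : ℝ) < (2.7182818283 : ℝ) ^ 2 := by norm_num
  linarith

/-- The prime sum `Σ_{a < p ≤ b} log p = θ(b) - θ(a)` as a sum over `primesLE ⌊b⌋ \ primesLE ⌊a⌋`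
(`0 ≤ a ≤ b`). [folklore] -/
theorem theta_sub_theta_eq_sum_sdiff {a b : ℝ} (hab : a ≤ b) :
    θ b - θ a = ∑ p ∈ Nat.primesLE ⌊b⌋₊ \ Nat.primesLE ⌊a⌋₊, Real.log p := by
  have hsub : Nat.primesLE ⌊a⌋₊ ⊆ Nat.primesLE ⌊b⌋₊ :=
    Nat.primesLE_mono (Nat.floor_le_floor hab)
  rw [theta_eq_sum_primesLE, theta_eq_sum_primesLE, ← Finset.sum_sdiff hsub]
  ring

/-- **Decay of `ζ(s, y)` in the range `π/log y ≤ |t| ≤ 3`** (the input for Hildebrand–Tenenbaum's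
Lemma 8 (ii)-type bounds, here from Chebyshev's estimates alone): there are `c > 0` and `y₀` with
`Σ_{p ≤ y} p^{-σ}(1 - cos(t log p)) ≥ c · y^{(1-σ)/2}/log y` for all `y ≥ y₀`, `3/5 ≤ σ ≤ 1` and
`π/log y ≤ |t| ≤ 3`. Proof: on the logarithmic scale the "bad" `log p` (with `t log p` within `1/10` of
`2πℤ`) form `(1/(10|t|))`-neighbourhoods of `(2π/|t|)ℤ`; by `exists_good_subinterval` the window
`[½ log y, log y]` contains a good interval `[ℓ₀, ℓ₀ + 2]`, and the primes `e^{ℓ₀} < p ≤ e^{ℓ₀ + 2}` have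
`θ`-mass `≥ ((log 2)/2 · e² - log 4) e^{ℓ₀} - c₁ ≥ e^{ℓ₀}`, each contributing `≥ (1 - cos(1/10)) e^{-2}
e^{-σ ℓ₀}`. [cite: HildebrandTenenbaum1986, §3 Lemma 8 (ii)] -/
theorem exists_decaySum_ge_sqrt :
    ∃ c : ℝ, 0 < c ∧ ∃ y₀ : ℕ, ∀ y : ℕ, y₀ ≤ y → ∀ σ : ℝ, 3 / 5 ≤ σ → σ ≤ 1 → ∀ t : ℝ,
      Real.pi / Real.log y ≤ |t| → |t| ≤ 3 →
        c * ((y : ℝ) ^ ((1 - σ) / 2) / Real.log y) ≤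
          ∑ p ∈ Nat.primesLE y, (p : ℝ) ^ (-σ) * (1 - Real.cos (t * Real.log p)) := by
  obtain ⟨c₁, hc₁, hθ⟩ := exists_theta_ge_linear
  set δ : ℝ := 1 - Real.cos (1 / 10) with hδ
  have hδ0 : 0 < δ := by
    have h := two_div_pi_sq_mul_sq_le_one_sub_cos (φ := 1 / 10)
      (by rw [abs_of_nonneg (by norm_num)]; linarith [Real.pi_gt_d2])
    have : 0 < 2 / Real.pi ^ 2 * (1 / 10 : ℝ) ^ 2 := by positivity
    linarith
  -- thresholds on `y`: `log y ≥ 10` and `√y ≥ 6 c₁ + 1`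
  set Y : ℝ := max (Real.exp 10) ((6 * c₁ + 1) ^ 2) with hY
  refine ⟨δ * Real.exp (-2), by positivity, ⌈Y⌉₊, fun y hy σ hσ35 hσ1 t ht1 ht3 => ?_⟩
  have hyY : Y ≤ y := le_trans (Nat.le_ceil Y) (by exact_mod_cast hy)
  have hy10 : Real.exp 10 ≤ y := le_trans (le_max_left _ _) hyY
  have hy0 : (0 : ℝ) < y := lt_of_lt_of_le (Real.exp_pos _) hy10
  have hy1 : (1 : ℝ) < y := lt_of_lt_of_le (by have := Real.add_one_le_exp (10 : ℝ); linarith) hy10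
  have hlogy : 10 ≤ Real.log y := by
    have := Real.log_le_log (Real.exp_pos _) hy10; rwa [Real.log_exp] at this
  have hlogy0 : 0 < Real.log y := by linarith
  have hsqrt_y : 6 * c₁ + 1 ≤ (y : ℝ) ^ (1 / 2 : ℝ) := by
    have h1 : (6 * c₁ + 1) ^ 2 ≤ y := le_trans (le_max_right _ _) hyY
    have h2 := Real.rpow_le_rpow (by positivity) h1 (by norm_num : (0 : ℝ) ≤ 1 / 2)
    rwa [← Real.rpow_natCast, ← Real.rpow_mul (by positivity), show ((2 : ℕ) : ℝ) * (1 / 2) = 1 by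
      norm_num, Real.rpow_one] at h2
  -- reduce to `t > 0`
  wlog htpos : 0 < t generalizing t
  · have ht0 : t ≤ 0 := le_of_not_gt htpos
    have htne : t ≠ 0 := by
      intro h; rw [h, abs_zero] at ht1
      have : 0 < Real.pi / Real.log y := div_pos Real.pi_pos hlogy0
      linarith
    have h := this (-t) (by rwa [abs_neg]) (by rwa [abs_neg]) (by
      rcases lt_or_eq_of_le ht0 with h | h
      · linarith
      · exact absurd h htne)
    simpa [neg_mul, Real.cos_neg] using h
  rw [abs_of_pos htpos] at ht1 ht3
  have hπ := Real.pi_gt_d2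
  have hπ' := Real.pi_lt_d2
  -- the good sub-interval on the logarithmic scale
  set P : ℝ := 2 * Real.pi / t with hP
  set r : ℝ := (1 / 10) / t with hr
  have hP0 : 0 < P := by positivity
  have hr0 : 0 ≤ r := by positivity
  have htlogy : Real.pi ≤ t * Real.log y := by rwa [div_le_iff₀ hlogy0] at ht1
  have hgap : (2 : ℝ) ≤ P - 2 * r := by
    have heq : P - 2 * r = (2 * Real.pi - 1 / 5) / t := by rw [hP, hr]; field_simp; ring
    rw [heq, le_div_iff₀ htpos]
    nlinarith
  have hW : 2 * (2 : ℝ) + 2 * r ≤ Real.log y / 2 := by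
    -- `r = 1/(10 t) ≤ log y/(10 π)`
    have hr_le : r ≤ Real.log y / (10 * Real.pi) := by
      rw [hr, div_le_div_iff₀ htpos (by positivity)]
      nlinarith
    have : Real.log y / (10 * Real.pi) ≤ Real.log y / 31 := by
      apply div_le_div_of_nonneg_left hlogy0.le (by norm_num) (by nlinarith)
    linarith
  obtain ⟨ℓ₀, hℓ₀A, hℓ₀W, hgood⟩ :=
    exists_good_subinterval (A := Real.log y / 2) hP0 hr0 two_pos hgap hW
  -- the multiplicative interval `(a, b]`, `a = e^{ℓ₀}`, `b = e^{ℓ₀ + 2}`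
  set a : ℝ := Real.exp ℓ₀ with ha
  set b : ℝ := Real.exp (ℓ₀ + 2) with hb
  have ha0 : 0 < a := Real.exp_pos _
  have hab : a ≤ b := Real.exp_le_exp.2 (by linarith)
  have hb_eq : b = Real.exp 2 * a := by rw [hb, ha, ← Real.exp_add]; ring_nf
  have hby : b ≤ y := by
    calc b ≤ Real.exp (Real.log y) := Real.exp_le_exp.2 (by linarith)
      _ = y := Real.exp_log hy0
  have ha_sqrt : (y : ℝ) ^ (1 / 2 : ℝ) ≤ a := by
    calc (y : ℝ) ^ (1 / 2 : ℝ) = Real.exp (Real.log y * (1 / 2)) := Real.rpow_def_of_pos hy0 _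
      _ ≤ Real.exp ℓ₀ := Real.exp_le_exp.2 (by linarith)
  have ha_ge : 6 * c₁ + 1 ≤ a := le_trans hsqrt_y ha_sqrt
  -- `θ(b) - θ(a) ≥ a`
  have hmass : a ≤ θ b - θ a := by
    have h1 := hθ b (by linarith)
    have h2 := theta_le_log4_mul_x ha0.le
    have hl2 := Real.log_two_gt_d9
    have hl4 : Real.log 4 ≤ 1.3863 := by
      have h : Real.log 4 = 2 * Real.log 2 := by
        rw [show (4 : ℝ) = 2 ^ 2 by norm_num, Real.log_pow]; push_cast; ring
      rw [h]; have := Real.log_two_lt_d9; linarith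
    have he2 := exp_two_gt
    rw [hb_eq] at h1 ⊢
    nlinarith [Real.exp_pos 2]
  -- the sub-sum over the primes in `(a, b]`
  have hsub : Nat.primesLE ⌊b⌋₊ \ Nat.primesLE ⌊a⌋₊ ⊆ Nat.primesLE y := by
    intro p hp
    obtain ⟨hpb, -⟩ := Finset.mem_sdiff.1 hp
    obtain ⟨hple, hpp⟩ := Nat.mem_primesLE.1 hpb
    refine Nat.mem_primesLE.2 ⟨?_, hpp⟩
    have : ⌊b⌋₊ ≤ y := Nat.floor_le_of_le (by exact_mod_cast hby)
    omega
  have hterm : ∀ p ∈ Nat.primesLE ⌊b⌋₊ \ Nat.primesLE ⌊a⌋₊,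
      δ * b ^ (-σ) / Real.log y * Real.log p ≤ (p : ℝ) ^ (-σ) * (1 - Real.cos (t * Real.log p)) := by
    intro p hp
    obtain ⟨hpb, hpa⟩ := Finset.mem_sdiff.1 hp
    obtain ⟨hple, hpp⟩ := Nat.mem_primesLE.1 hpb
    have hp0 : (0 : ℝ) < p := by exact_mod_cast hpp.pos
    have hp1 : (1 : ℝ) ≤ p := by exact_mod_cast hpp.one_lt.le
    -- `a < p ≤ b`
    have hpb' : (p : ℝ) ≤ b := by
      have := Nat.floor_le (show 0 ≤ b by positivity)
      exact le_trans (by exact_mod_cast hple) this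
    have hpa' : a < p := by
      have hnot : ¬ p ≤ ⌊a⌋₊ := fun h => hpa (Nat.mem_primesLE.2 ⟨h, hpp⟩)
      push Not at hnot
      exact lt_of_lt_of_le (Nat.lt_floor_add_one a) (by exact_mod_cast hnot)
    -- `log p ∈ (ℓ₀, ℓ₀ + 2]` is good
    have hlogp_mem : Real.log p ∈ Set.Icc ℓ₀ (ℓ₀ + 2) := by
      constructor
      · have := Real.log_le_log ha0 hpa'.le; rwa [ha, Real.log_exp] at this
      · have := Real.log_le_log hp0 hpb'; rwa [hb, Real.log_exp] at this
    have hdist : ∀ k : ℤ, 1 / 10 ≤ |t * Real.log p - k * (2 * Real.pi)| := by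
      intro k
      have h := hgood (Real.log p) hlogp_mem k
      have heq : t * Real.log p - k * (2 * Real.pi) = t * (Real.log p - k * P) := by
        rw [hP]; field_simp
      rw [heq, abs_mul, abs_of_pos htpos]
      calc (1 / 10 : ℝ) = t * r := by rw [hr]; field_simp
        _ ≤ t * |Real.log p - k * P| := mul_le_mul_of_nonneg_left h htpos.le
    have hcos : Real.cos (t * Real.log p) ≤ Real.cos (1 / 10) :=
      cos_le_cos_of_forall_dist (by norm_num) hdist
    have hone : δ ≤ 1 - Real.cos (t * Real.log p) := by rw [hδ]; linarith
    -- `p^{-σ} ≥ b^{-σ}`, `log p ≤ log y`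
    have hpow : b ^ (-σ) ≤ (p : ℝ) ^ (-σ) :=
      Real.rpow_le_rpow_of_nonpos hp0 hpb' (by linarith)
    have hlogp : Real.log p ≤ Real.log y := Real.log_le_log hp0 (le_trans hpb' hby)
    have hlogp0 : 0 ≤ Real.log p := Real.log_nonneg hp1
    have hbσ : 0 < b ^ (-σ) := Real.rpow_pos_of_pos (by positivity) _
    calc δ * b ^ (-σ) / Real.log y * Real.log p = (δ * b ^ (-σ)) * (Real.log p / Real.log y) := by
          field_simp
      _ ≤ (δ * b ^ (-σ)) * 1 := by
          refine mul_le_mul_of_nonneg_left ?_ (by positivity)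
          rwa [div_le_one hlogy0]
      _ = b ^ (-σ) * δ := by ring
      _ ≤ (p : ℝ) ^ (-σ) * (1 - Real.cos (t * Real.log p)) :=
          mul_le_mul hpow hone hδ0.le (Real.rpow_nonneg hp0.le _)
  -- assemble
  have hnonneg : ∀ p ∈ Nat.primesLE y, 0 ≤ (p : ℝ) ^ (-σ) * (1 - Real.cos (t * Real.log p)) := by
    intro p hp
    have hp0 : (0 : ℝ) ≤ p := Nat.cast_nonneg _
    exact mul_nonneg (Real.rpow_nonneg hp0 _) (by linarith [Real.cos_le_one (t * Real.log p)])
  have hbσ : 0 < b ^ (-σ) := Real.rpow_pos_of_pos (by positivity) _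
  calc δ * Real.exp (-2) * ((y : ℝ) ^ ((1 - σ) / 2) / Real.log y)
      ≤ δ * b ^ (-σ) / Real.log y * a := by
        -- `e^{-2} y^{(1-σ)/2} ≤ e^{-2} a^{1-σ} ≤ b^{-σ} a`
        have h1 : (y : ℝ) ^ ((1 - σ) / 2) ≤ a ^ (1 - σ) := by
          calc (y : ℝ) ^ ((1 - σ) / 2) = ((y : ℝ) ^ (1 / 2 : ℝ)) ^ (1 - σ) := by
                rw [← Real.rpow_mul hy0.le]; ring_nf
            _ ≤ a ^ (1 - σ) := Real.rpow_le_rpow (by positivity) ha_sqrt (by linarith)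
        have h2 : Real.exp (-2) * a ^ (1 - σ) ≤ b ^ (-σ) * a := by
          have hsplit : a ^ (1 - σ) = a ^ (-σ) * a := by
            rw [show (1 : ℝ) - σ = -σ + 1 by ring, Real.rpow_add ha0, Real.rpow_one]
          have hbpow : b ^ (-σ) = Real.exp 2 ^ (-σ) * a ^ (-σ) := by
            rw [hb_eq, Real.mul_rpow (Real.exp_pos 2).le ha0.le]
          have he : Real.exp (-2) ≤ Real.exp 2 ^ (-σ) := by
            rw [← Real.exp_mul]
            exact Real.exp_le_exp.2 (by linarith)
          rw [hsplit, hbpow]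
          have : 0 ≤ a ^ (-σ) * a := by positivity
          calc Real.exp (-2) * (a ^ (-σ) * a) ≤ Real.exp 2 ^ (-σ) * (a ^ (-σ) * a) :=
                mul_le_mul_of_nonneg_right he this
            _ = Real.exp 2 ^ (-σ) * a ^ (-σ) * a := by ring
        calc δ * Real.exp (-2) * ((y : ℝ) ^ ((1 - σ) / 2) / Real.log y)
            = δ / Real.log y * (Real.exp (-2) * (y : ℝ) ^ ((1 - σ) / 2)) := by field_simp
          _ ≤ δ / Real.log y * (Real.exp (-2) * a ^ (1 - σ)) := by
              refine mul_le_mul_of_nonneg_left (mul_le_mul_of_nonneg_left h1 (Real.exp_pos _).le) ?_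
              positivity
          _ ≤ δ / Real.log y * (b ^ (-σ) * a) := mul_le_mul_of_nonneg_left h2 (by positivity)
          _ = δ * b ^ (-σ) / Real.log y * a := by field_simp
    _ ≤ δ * b ^ (-σ) / Real.log y * (θ b - θ a) :=
        mul_le_mul_of_nonneg_left hmass (by positivity)
    _ = ∑ p ∈ Nat.primesLE ⌊b⌋₊ \ Nat.primesLE ⌊a⌋₊, δ * b ^ (-σ) / Real.log y * Real.log p := by
        rw [theta_sub_theta_eq_sum_sdiff hab, Finset.mul_sum]
    _ ≤ ∑ p ∈ Nat.primesLE ⌊b⌋₊ \ Nat.primesLE ⌊a⌋₊,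
          (p : ℝ) ^ (-σ) * (1 - Real.cos (t * Real.log p)) := Finset.sum_le_sum hterm
    _ ≤ ∑ p ∈ Nat.primesLE y, (p : ℝ) ^ (-σ) * (1 - Real.cos (t * Real.log p)) :=
        Finset.sum_le_sum_of_subset_of_nonneg hsub fun p hp _ => hnonneg p hp

end Literature.NumberTheory.Sieve

end
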